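import Summits.AtomisticToContinuum.BoseEinsteinCondensation.Theorems.InfraredMinimumUncertainty.Negative.DensityWaveFisherMoments

/-!
# Negative lemmas for crux `InfraredMinimumUncertainty` (stmt-AtomisticToContinuum-11784) — VII:
# the stub `FisherGaussianity` of line `fisher-gaussian-density-mode` needs minimality too

Supports (does not close) stmt-AtomisticToContinuum-11784 (route `BECConjugateDomination`; picked
line `Cruxes/InfraredMinimumUncertainty/Lines/fisher-gaussian-density-mode.lean`, registered stub
`stub_fisherGaussianity : FisherGaussianity` of `Theorems/BECConjugateDominationDefs.lean`:
`∀ φ ∈ C¹, J_{Ψ,m}(φ)·(N S_m) ≤ C'` for positive minimisers).  Importable form of §F (second half) of the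
cdisprove seat's standing file `Cruxes/InfraredMinimumUncertainty/Disproof.lean`; the affine
field and the moment bounds are in `DensityWaveFisherMoments.lean`.

On the free density wave `Ψ = (c(1 + 2ε cos θ_{e₀}))^{⊗N}` of `FreeDensityWave.lean` (a positive,
real, finite-energy admissible state, `δ`-near-minimiser of the FREE gas for `ε² ≍ δL²/N`) the
Fisher test functional at the AFFINE REAL field `φ_{λ,μ}(z) = −λ(Re z − μ)` is
`J(φ_{λ,μ}) = 2λ − λ²·E(Re Z − μ)²` (`fisherTest_affineField`); with `μ = E Re Z = N·2ε/(1+2ε²)`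
the variance is `≤ N` (`variance_re_densityMode_waveState_le`, two-index Fubini on the product
state), so `λ = 1/N` gives `J ≥ 1/N` and `J·(N S_{e₀}) ≥ S_{e₀} ≥ N·4ε²/(1+2ε²)²` — a Bragg peak:

* `fg_free_near_minimiser_witness`, `eventually_lt_fg_free_near_minimiser`;
* `not_fisherGaussianityNearMinimisers` — FG with `E = E₀` weakened to `E ≤ E₀ + δ` (`δ > 0`
  before `N`) is FALSE; `fisherGaussianity_false_without_minimality` — FG with `E = E₀` deleted is
  FALSE; both refuted statements are strengthenings of FG (`not_fgNearMinimisers_of_not_fg`,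
  `fgNearMinimisers_of_withoutMinimality`).

So the "independently falsifiable residual" FG of the line uses the minimiser property exactly as
the crux does (any proof must resolve the first torus gap); its content for minimisers is a
Fisher-local-CLT at the scale `√(N S_k)`, untouched here.
-/

noncomputable section

open MeasureTheory Filter Set
open scoped ENNReal NNReal Topology ComplexConjugate BigOperators

namespace Summit.AtomisticToContinuum.BoseEinsteinCondensation.Theorems.InfraredMinimumUncertainty.Negative

open Literature.MathematicalPhysics.QuantumManyBody.BoseGas
open Summit.AtomisticToContinuum.BoseEinsteinCondensation.Theses.BECConjugateDomination
open Summit.AtomisticToContinuum.BoseEinsteinCondensation.Cruxes.InfraredMinimumUncertainty.FisherGaussianDensityMode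
open Summit.AtomisticToContinuum.BoseEinsteinCondensation.Theorems.GaussianDominationCan.Negative
  (prodFun contDiff_prodFun)
open Summit.AtomisticToContinuum.BoseEinsteinCondensation.Theorems.StaticResponseBound.Negative
  (arg re_cellWave isRepulsiveFiniteRange_zero integral_norm_sq_eq_one)
open Summit.AtomisticToContinuum.BoseEinsteinCondensation.Theorems.CorrectorClosure.Negative
  (e0 e0_ne_zero sideLength_succ_pos)

/-! ### FG needs minimality: the witness and the refuted strengthenings -/

section FGLoadBearing

/-- **THE FG WITNESS.** Free gas, any `ρ > 0`, any `N = n+1`, any slack `δ > 0`: the density wave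
of amplitude `ε² = min(1/16, δL²/(16π²N))` is a positive real admissible state with
`periodicEnergy 0 Ψ ≤ δ`, and at the `C¹` field `φ_{1/N,μ_N}` one has
`J(φ)·(N S_{e₀}) ≥ 3·min(N/16, δL²/(16π²))` (`≥ S_{e₀} ≥ (256/81)ε²N`). [folklore] -/
theorem fg_free_near_minimiser_witness {ρ : ℝ} (hρ : 0 < ρ) (n : ℕ) {δ : ℝ} (hδ : 0 < δ) :
    ∃ Ψ : PeriodicTrialState (n + 1) (sideLength ρ (n + 1)),
      periodicEnergy 0 Ψ ≤ ENNReal.ofReal δ ∧ (∀ X, Ψ.ψ X = (‖Ψ.ψ X‖ : ℂ)) ∧ (∀ X, Ψ.ψ X ≠ 0) ∧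
        ∃ φ : ℂ → ℂ, ContDiff ℝ 1 φ ∧
          3 * min (((n : ℝ) + 1) / 16) (δ * sideLength ρ (n + 1) ^ 2 / (16 * Real.pi ^ 2)) ≤
            fisherTest n (sideLength ρ (n + 1)) Ψ e0 φ *
              (((n : ℝ) + 1) * structureFactor n (sideLength ρ (n + 1)) Ψ e0) := by
  set L := sideLength ρ (n + 1) with hLdef
  have hL : 0 < L := sideLength_succ_pos hρ n
  have hN : (0 : ℝ) < (n : ℝ) + 1 := by positivity
  set s : ℝ := min (1 / 16) (δ * L ^ 2 / (16 * Real.pi ^ 2 * ((n : ℝ) + 1))) with hs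
  have hs0 : 0 < s := lt_min (by norm_num) (by positivity)
  have hs16 : s ≤ 1 / 16 := min_le_left _ _
  set ε : ℝ := Real.sqrt s with hεdef
  have hε2 : ε ^ 2 = s := Real.sq_sqrt hs0.le
  have hεpos : 0 < ε := Real.sqrt_pos.mpr hs0
  have hε : |ε| < 1 / 2 := by
    rw [abs_of_pos hεpos]
    have : ε ≤ Real.sqrt (1 / 16) := Real.sqrt_le_sqrt hs16
    rw [show (1 / 16 : ℝ) = (1 / 4) ^ 2 by norm_num, Real.sqrt_sq (by norm_num)] at this
    linarith
  refine ⟨waveState n hL ε, ?_, waveFun_eq_norm hL hε, waveFun_ne_zero hL hε,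
    affineField ((n : ℝ) + 1)⁻¹ (waveMean n ε), contDiff_affineField _ _, ?_⟩
  · refine (periodicEnergy_waveState_le hL).trans (ENNReal.ofReal_le_ofReal ?_)
    rw [hε2, div_le_iff₀ (by positivity : (0 : ℝ) < L ^ 2)]
    have h2 : s ≤ δ * L ^ 2 / (16 * Real.pi ^ 2 * ((n : ℝ) + 1)) := min_le_right _ _
    rw [le_div_iff₀ (by positivity)] at h2
    linarith
  · have hJ := fisherTest_waveState_ge (n := n) hL hε
    have hS := structureFactor_waveState_ge (n := n) hL hε
    have hNS : 0 ≤ ((n : ℝ) + 1) * structureFactor n L (waveState n hL ε) e0 :=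
      mul_structureFactor_nonneg n L _ e0
    -- `J · (N S) ≥ (1/N)(N S) = S ≥ N (2ε/(1+2ε²))² ≥ (256/81) s N ≥ 3 s N`
    have h1 : ((n : ℝ) + 1)⁻¹ * (((n : ℝ) + 1) * structureFactor n L (waveState n hL ε) e0) ≤
        fisherTest n L (waveState n hL ε) e0 (affineField ((n : ℝ) + 1)⁻¹ (waveMean n ε)) *
          (((n : ℝ) + 1) * structureFactor n L (waveState n hL ε) e0) :=
      mul_le_mul_of_nonneg_right hJ hNS
    rw [← mul_assoc, inv_mul_cancel₀ hN.ne', one_mul] at h1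
    refine le_trans ?_ (hS.trans h1)
    have hq : 0 < 1 + 2 * ε ^ 2 := by positivity
    have hkey : 3 * s ≤ (2 * ε / (1 + 2 * ε ^ 2)) ^ 2 := by
      rw [div_pow, le_div_iff₀ (by positivity)]
      have h4 : (2 * ε) ^ 2 = 4 * s := by rw [mul_pow, hε2]; norm_num
      have h5 : (1 + 2 * ε ^ 2) ^ 2 = (1 + 2 * s) ^ 2 := by rw [hε2]
      rw [h4, h5]
      nlinarith [mul_nonneg hs0.le (show (0 : ℝ) ≤ 4 - 3 * (1 + 2 * s) ^ 2 by nlinarith)]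
    rcases min_cases (1 / 16 : ℝ) (δ * L ^ 2 / (16 * Real.pi ^ 2 * ((n : ℝ) + 1))) with ⟨h, _⟩ | ⟨h, _⟩
    · rw [← hs] at h
      calc 3 * min (((n : ℝ) + 1) / 16) (δ * L ^ 2 / (16 * Real.pi ^ 2))
          ≤ 3 * (((n : ℝ) + 1) / 16) := by
            refine mul_le_mul_of_nonneg_left (min_le_left _ _) (by norm_num)
        _ = ((n : ℝ) + 1) * (3 * s) := by rw [h]; ring
        _ ≤ ((n : ℝ) + 1) * (2 * ε / (1 + 2 * ε ^ 2)) ^ 2 := mul_le_mul_of_nonneg_left hkey hN.le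
    · rw [← hs] at h
      calc 3 * min (((n : ℝ) + 1) / 16) (δ * L ^ 2 / (16 * Real.pi ^ 2))
          ≤ 3 * (δ * L ^ 2 / (16 * Real.pi ^ 2)) := by
            refine mul_le_mul_of_nonneg_left (min_le_right _ _) (by norm_num)
        _ = ((n : ℝ) + 1) * (3 * s) := by rw [h]; field_simp
        _ ≤ ((n : ℝ) + 1) * (2 * ε / (1 + 2 * ε ^ 2)) ^ 2 := mul_le_mul_of_nonneg_left hkey hN.le

/-- **`J·(N S) → ∞` along free near-minimisers at FIXED slack.** [folklore] -/
theorem eventually_lt_fg_free_near_minimiser {ρ : ℝ} (hρ : 0 < ρ) {δ : ℝ} (hδ : 0 < δ) (C : ℝ) :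
    ∀ᶠ n : ℕ in atTop, ∃ Ψ : PeriodicTrialState (n + 1) (sideLength ρ (n + 1)),
      periodicEnergy 0 Ψ ≤ ENNReal.ofReal δ ∧
      periodicEnergy 0 Ψ ≤ periodicGroundStateEnergy 0 (n + 1) (sideLength ρ (n + 1)) +
          ENNReal.ofReal δ ∧
        (∀ X, Ψ.ψ X = (‖Ψ.ψ X‖ : ℂ)) ∧ (∀ X, Ψ.ψ X ≠ 0) ∧
          ∃ φ : ℂ → ℂ, ContDiff ℝ 1 φ ∧
            C < fisherTest n (sideLength ρ (n + 1)) Ψ e0 φ *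
              (((n : ℝ) + 1) * structureFactor n (sideLength ρ (n + 1)) Ψ e0) := by
  set K : ℝ := 16 * Real.pi ^ 2 * (max C 0 + 1) / (3 * δ) with hK
  have hC0 : 0 ≤ max C 0 := le_max_right _ _
  have hK0 : 0 < K := by positivity
  set M : ℝ := max K 1 with hM
  have hM1 : 1 ≤ M := le_max_right _ _
  have h1 : ∀ᶠ n : ℕ in atTop, ρ * M ^ 3 < (n : ℝ) :=
    tendsto_natCast_atTop_atTop.eventually_gt_atTop _
  have h2 : ∀ᶠ n : ℕ in atTop, 16 * (max C 0 + 1) < (n : ℝ) :=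
    tendsto_natCast_atTop_atTop.eventually_gt_atTop _
  filter_upwards [h1, h2] with n hn1 hn2
  obtain ⟨Ψ, hE, hreal, hpos, φ, hφ, hJ⟩ := fg_free_near_minimiser_witness hρ n hδ
  refine ⟨Ψ, hE, hE.trans le_add_self, hreal, hpos, φ, hφ, lt_of_lt_of_le ?_ hJ⟩
  have hL3 := sideLength_succ_pow_three hρ n
  set L := sideLength ρ (n + 1) with hLdef
  have hL : 0 < L := sideLength_succ_pos hρ n
  have hLM : M < L := by
    refine lt_of_pow_lt_pow_left₀ 3 hL.le ?_
    rw [hL3, lt_div_iff₀ hρ]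
    have hM0 : 0 ≤ M ^ 3 := by positivity
    nlinarith
  have hL1 : 1 ≤ L := hM1.trans hLM.le
  have hKL : K < L := (le_max_left _ _).trans_lt hLM
  have hLL : L ≤ L ^ 2 := by nlinarith
  have hC : C < max C 0 + 1 := by have := le_max_left C 0; linarith
  refine hC.trans_le ?_
  rw [mul_min_of_nonneg _ _ (by norm_num : (0 : ℝ) ≤ 3)]
  refine le_min ?_ ?_
  · nlinarith
  · have hKdef : K * (3 * δ) = 16 * Real.pi ^ 2 * (max C 0 + 1) := by
      rw [hK]; field_simp
    have hpi : 0 < 16 * Real.pi ^ 2 := by positivity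
    rw [show 3 * (δ * L ^ 2 / (16 * Real.pi ^ 2)) = 3 * δ * L ^ 2 / (16 * Real.pi ^ 2) by ring,
      le_div_iff₀ hpi]
    have : K * (3 * δ) ≤ L ^ 2 * (3 * δ) :=
      mul_le_mul_of_nonneg_right (hKL.le.trans hLL) (by positivity)
    linarith [hKdef]

/-- FG with the minimiser hypothesis WEAKENED to a `δ`-near-minimiser hypothesis (`δ > 0` chosen
after `ρ`, before `N`) — everything else verbatim from `FisherGaussianity`.  A strengthening of
FG (`not_fgNearMinimisers_of_not_fg`). -/
def FisherGaussianityNearMinimisers : Prop :=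
  ∀ v : ℝ → ℝ≥0∞, InSmoothClass v → ∃ C : ℝ, 0 ≤ C ∧ ∃ ρ₀ : ℝ, 0 < ρ₀ ∧ ∀ ρ : ℝ, 0 < ρ → ρ < ρ₀ →
    ∃ δ : ℝ, 0 < δ ∧ ∀ᶠ n : ℕ in atTop, ∀ Ψ : PeriodicTrialState (n + 1) (sideLength ρ (n + 1)),
      periodicEnergy v Ψ ≤ periodicGroundStateEnergy v (n + 1) (sideLength ρ (n + 1)) +
          ENNReal.ofReal δ →
        periodicEnergy v Ψ ≠ ⊤ → (∀ X, Ψ.ψ X = (‖Ψ.ψ X‖ : ℂ)) → (∀ X, Ψ.ψ X ≠ 0) →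
          ∀ m : Fin 3 → ℤ, m ≠ 0 → ∀ φ : ℂ → ℂ, ContDiff ℝ 1 φ →
            fisherTest n (sideLength ρ (n + 1)) Ψ m φ *
              (((n : ℝ) + 1) * structureFactor n (sideLength ρ (n + 1)) Ψ m) ≤ C

/-- FG with the minimiser hypothesis DELETED (finite energy, `Ψ = |Ψ| > 0` kept). -/
def FisherGaussianityWithoutMinimality : Prop :=
  ∀ v : ℝ → ℝ≥0∞, InSmoothClass v → ∃ C : ℝ, 0 ≤ C ∧ ∃ ρ₀ : ℝ, 0 < ρ₀ ∧ ∀ ρ : ℝ, 0 < ρ → ρ < ρ₀ →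
    ∀ᶠ n : ℕ in atTop, ∀ Ψ : PeriodicTrialState (n + 1) (sideLength ρ (n + 1)),
      periodicEnergy v Ψ ≠ ⊤ → (∀ X, Ψ.ψ X = (‖Ψ.ψ X‖ : ℂ)) → (∀ X, Ψ.ψ X ≠ 0) →
        ∀ m : Fin 3 → ℤ, m ≠ 0 → ∀ φ : ℂ → ℂ, ContDiff ℝ 1 φ →
          fisherTest n (sideLength ρ (n + 1)) Ψ m φ *
            (((n : ℝ) + 1) * structureFactor n (sideLength ρ (n + 1)) Ψ m) ≤ C

/-- The near-minimiser version is a STRENGTHENING of FG (stated contrapositively: no theorem of this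
negative-side file concludes the registered stub signature). [folklore] -/
theorem not_fgNearMinimisers_of_not_fg (h : ¬ FisherGaussianity) : ¬ FisherGaussianityNearMinimisers := by
  intro hNM
  refine h fun v hv => ?_
  obtain ⟨C, hC, ρ₀, hρ₀, hB⟩ := hNM v hv
  refine ⟨C, hC, ρ₀, hρ₀, fun ρ hρ hρρ₀ => ?_⟩
  obtain ⟨δ, _hδ, hev⟩ := hB ρ hρ hρρ₀
  filter_upwards [hev] with n hn Ψ hΨ m hm φ hφ
  exact hn Ψ (hΨ.1.le.trans le_self_add) hΨ.2.1 hΨ.2.2.1 hΨ.2.2.2 m hm φ hφ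

/-- The minimality-free version implies the near-minimiser version. [folklore] -/
theorem fgNearMinimisers_of_withoutMinimality (h : FisherGaussianityWithoutMinimality) :
    FisherGaussianityNearMinimisers := by
  intro v hv
  obtain ⟨C, hC, ρ₀, hρ₀, hB⟩ := h v hv
  refine ⟨C, hC, ρ₀, hρ₀, fun ρ hρ hρρ₀ => ⟨1, one_pos, ?_⟩⟩
  filter_upwards [hB ρ hρ hρρ₀] with n hn Ψ _hE hfin hreal hpos m hm φ hφ
  exact hn Ψ hfin hreal hpos m hm φ hφ

/-- **MINIMALITY IS LOAD-BEARING FOR THE STUB `FisherGaussianity` (near-minimiser form).** FG with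
`E = E₀` weakened to `E ≤ E₀ + δ` (`δ > 0` before `N`) is FALSE: witness `v ≡ 0`, the free
density waves and the affine real field `φ_{1/N,μ_N}`; `J·(N S_{e₀}) ≥ S_{e₀} → ∞`
(a Bragg peak is Fisher-non-Gaussian at its own scale). [folklore] -/
theorem not_fisherGaussianityNearMinimisers : ¬ FisherGaussianityNearMinimisers := by
  intro h
  obtain ⟨C, _hC, ρ₀, hρ₀, hB⟩ := h 0 inSmoothClass_zero
  have hρ : (0 : ℝ) < ρ₀ / 2 := by positivity
  obtain ⟨δ, hδ, hev⟩ := hB (ρ₀ / 2) hρ (by linarith)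
  obtain ⟨n, hn, Ψ, hEδ, hE, hreal, hpos, φ, hφ, hJ⟩ :=
    (hev.and (eventually_lt_fg_free_near_minimiser hρ hδ C)).exists
  have hfin : periodicEnergy 0 Ψ ≠ ⊤ := ne_top_of_le_ne_top ENNReal.ofReal_ne_top hEδ
  exact absurd (hn Ψ hE hfin hreal hpos e0 e0_ne_zero φ hφ) (not_le.mpr hJ)

/-- **MINIMALITY IS LOAD-BEARING FOR `FisherGaussianity`.**  FG with the minimiser hypothesis
deleted is FALSE. [folklore] -/
theorem fisherGaussianity_false_without_minimality : ¬ FisherGaussianityWithoutMinimality :=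
  fun h => not_fisherGaussianityNearMinimisers (fgNearMinimisers_of_withoutMinimality h)

end FGLoadBearing

end Summit.AtomisticToContinuum.BoseEinsteinCondensation.Theorems.InfraredMinimumUncertainty.Negative

end
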